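import Summits.ValiantsHypothesis.ValiantsHypothesis.Theses.ShallowShadows
import Summits.ValiantsHypothesis.ValiantsHypothesis.Theorems.ShadowFormulaTransfer.Negative.FalseWithoutZeroOne
import Summits.ValiantsHypothesis.ValiantsHypothesis.Theorems.ShallowShadowsRazWigdersonMatching
import Literature.Computability.AlgebraicComplexity.CircuitArithmetization
import Mathlib.Analysis.SpecialFunctions.Log.Base

/-!
# Crux `ShadowFormulaTransfer` (stmt-ValiantsHypothesis-17124) is summit-strength and beyond:
# it proves `L_ℂ(per_m) > 2^{m^ε}` and `per ∉ VQP_ℂ`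

Strength placement for the tribunal (crux-strategist r1 of route `ShallowShadows`; companion of
`Negative/FalseWithoutZeroOne.lean`, `Negative/FalseOverCharTwo.lean`, `Negative/VarsCalibration.lean`).

X = `ShadowFormulaTransfer` says: for every 0/1-coefficient VP family `f`, the monotone formula
size of the shadow `B(f_n)` is eventually `≤ 2^{deg(f_n)^{1-δ} (log(n+2))^C + C}`. The route's
deciding theorem uses X only at `f = per` to get `per ∉ VP_ℂ` (= the summit). This file proves
that X in fact yields, with the SAME in-tree far side (Raz–Wigderson, now a theorem:
`razWigdersonMatching_proof`), an exponential-type lower bound for the permanent,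

  `two_pow_rpow_lt_complexity_per`:  X → ∃ ε > 0, ∃ m₀, ∀ m ≥ m₀, 2^{m^ε} < L_ℂ(per_m)`,

and hence `per ∉ VQP_ℂ` (`not_isVQPFamily_per`), i.e. the EXTENDED Valiant hypothesis
`VNP ⧵ VQP ≠ ∅` over `ℂ` (Bürgisser–Clausen–Shokrollahi 1997, (21.32)/(21.41), open Problem 21.5;
per is VNP-complete and VQP is closed under p-projections) — a statement above the summit
`VP_ℂ ≠ VNP_ℂ` in the conjectural hierarchy (no implication from `per ∉ VP` to `per ∉ VQP` is
known), while `2^{m^{Ω(1)}}` lower bounds for `per` are beyond every known technique (the record for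
general circuits is `Ω(n log n)`, Baur–Strassen).

PROOF (padding normal form, Disproof §3.3 / `VarsCalibration`): suppose `L(per_m) ≤ 2^{m^ε}` for
infinitely many `m`, `ε = min(δ,1)/(2C+2)`. The padded permanent `f_n = per_m` (`m = (unpair n).1`)
if `L(per_m) ≤ n` else `0` is a 0/1 VP family BY FIAT; X bounds `log₂ L(PM_m)` at the index
`n = ⟨m, max(n₀, L(per_m))⟩ ≤ (m + n₀ + 2^{m^ε} + 2)²` by `m^{1-δ} (log(n+2))^C + C
≤ m^{1-δ} (A m^ε)^C + C ≤ A^C m^{1-δ/2} + C`, `A = 4/ε + 2`, which loses against Raz–Wigderson's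
`c·m` for large `m`. So the polylog factor `(log(n+2))^C` of X is `polylog(CIRCUIT SIZE)`, and X
reads: every 0/1 polynomial `g` computed in size `s` has `log₂ L(B g) ≤ deg(g)^{1-δ} polylog(s)`;
at `g = per_m` this is `polylog(L(per_m)) ≥ c m^δ`, i.e. `L(per_m) ≥ 2^{m^{Ω(1)}}`.

Consequence for the crux chain: every registered line's open stub implies X through its
kernel-checked `ShadowFormulaTransfer_of`, hence implies `L_ℂ(per_m) > 2^{m^ε}`; no line can be
"short of the summit" — each is at least an exponential permanent lower bound.
-/

noncomputable section

namespace Summit.ValiantsHypothesis.ValiantsHypothesis.Theorems.ShadowFormulaTransfer.Negative.SummitStrength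

set_option linter.dupNamespace false

open Literature.Computability.AlgebraicComplexity Literature.Computability.Complexity
open Literature.Barriers.PneNP MvPolynomial Filter
open Summit.ValiantsHypothesis.ValiantsHypothesis.Theses.ShallowShadows

/-- **X ⟹ exponential-type circuit lower bound for the permanent (far side as hypothesis).**
`RazWigdersonMatching → ShadowFormulaTransfer → ∃ ε > 0, ∀ᶠ m, 2^{m^ε} < L_ℂ(per_m)`.
Padded-permanent argument, see the module docstring. [folklore] -/
theorem two_pow_rpow_lt_complexity_per_of_razWigderson (hRW : RazWigdersonMatching)
    (hX : ShadowFormulaTransfer) :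
    ∃ ε : ℝ, 0 < ε ∧ ∃ m₀ : ℕ, ∀ m ≥ m₀,
      (2 : ℝ) ^ ((m : ℝ) ^ ε) < (complexity (perPoly (Fin m) ℂ) : ℝ) := by
  obtain ⟨δ, hδ, C, hC⟩ := hX
  obtain ⟨c, hc, m₀, hm₀⟩ := hRW
  -- §1 the padded permanent family (as in `Negative/VarsCalibration.lean`)
  let padPer : ∀ n : ℕ, MvPolynomial (Fin (Nat.unpair n).1 × Fin (Nat.unpair n).1) ℂ :=
    fun n => if complexity (perPoly (Fin (Nat.unpair n).1) ℂ) ≤ n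
      then perPoly (Fin (Nat.unpair n).1) ℂ else 0
  have hpad_of : ∀ n, complexity (perPoly (Fin (Nat.unpair n).1) ℂ) ≤ n →
      padPer n = perPoly (Fin (Nat.unpair n).1) ℂ := fun n h => if_pos h
  have hpad_not : ∀ n, ¬ complexity (perPoly (Fin (Nat.unpair n).1) ℂ) ≤ n → padPer n = 0 :=
    fun n h => if_neg h
  have hVP : IsVPFamily padPer := by
    refine ⟨⟨⟨2, fun n => ?_⟩, ⟨1, fun n => ?_⟩⟩, ⟨1, fun n => ?_⟩⟩
    · simp only [Fintype.card_prod, Fintype.card_fin]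
      have := Nat.unpair_left_le n
      nlinarith
    · show (padPer n).totalDegree ≤ n ^ 1 + 1
      by_cases h : complexity (perPoly (Fin (Nat.unpair n).1) ℂ) ≤ n
      · rw [hpad_of n h, totalDegree_perPoly_fin, pow_one]
        have := Nat.unpair_left_le n
        omega
      · rw [hpad_not n h, MvPolynomial.totalDegree_zero, pow_one]
        omega
    · show complexity (padPer n) ≤ n ^ 1 + 1
      by_cases h : complexity (perPoly (Fin (Nat.unpair n).1) ℂ) ≤ n
      · rw [hpad_of n h, pow_one]; omega
      · rw [hpad_not n h, CircuitArith.complexity_zero', pow_one]; omega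
  have h01 : ∀ (n : ℕ) (mo : Fin (Nat.unpair n).1 × Fin (Nat.unpair n).1 →₀ ℕ),
      (padPer n).coeff mo = 0 ∨ (padPer n).coeff mo = 1 := by
    intro n mo
    by_cases h : complexity (perPoly (Fin (Nat.unpair n).1) ℂ) ≤ n
    · rw [hpad_of n h]; exact coeff_perPoly_zeroOne _ mo
    · rw [hpad_not n h]; simp
  obtain ⟨n₀, hn₀⟩ := hC (fun n => Fin (Nat.unpair n).1 × Fin (Nat.unpair n).1) padPer hVP h01
  -- §2 the exponent `ε = min(δ,1)/(2C+2)` and the window at rate `c / A^C`, `A = 4/ε + 2`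
  have hC0 : (0 : ℝ) ≤ C := Nat.cast_nonneg C
  obtain ⟨δ₁, hδ₁, hδ₁δ, hδ₁1⟩ : ∃ δ₁ : ℝ, 0 < δ₁ ∧ δ₁ ≤ δ ∧ δ₁ ≤ 1 :=
    ⟨min δ 1, lt_min hδ one_pos, min_le_left _ _, min_le_right _ _⟩
  obtain ⟨ε, hε, hε1, hεC⟩ : ∃ ε : ℝ, 0 < ε ∧ ε ≤ 1 ∧ ε * C ≤ δ / 2 := by
    refine ⟨δ₁ / (2 * C + 2), by positivity, ?_, ?_⟩
    · rw [div_le_one (by positivity)]; linarith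
    · rw [div_mul_eq_mul_div, div_le_div_iff₀ (by positivity) two_pos]
      have := mul_le_mul_of_nonneg_right hδ₁δ hC0
      nlinarith
  obtain ⟨A, hA⟩ : ∃ A : ℝ, A = 4 / ε + 2 := ⟨_, rfl⟩
  have hA1 : 1 ≤ A := by
    have : 0 ≤ 4 / ε := by positivity
    linarith
  have hAC : 1 ≤ A ^ C := one_le_pow₀ hA1
  have hACpos : 0 < A ^ C := by positivity
  have hδ2 : 0 < δ / 2 := by positivity
  have hrate : 0 < c / A ^ C := by positivity
  obtain ⟨N, hN⟩ := eventually_atTop.mp ((tendsto_natCast_atTop_atTop (R := ℝ)).eventually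
    (eventually_window (δ / 2) hδ2 C (c / A ^ C) hrate))
  -- §3 suppose `L(per_m) ≤ 2^{m^ε}` for arbitrarily large `m`
  by_contra! hcon
  obtain ⟨m, hmM, hsmall⟩ := hcon ε hε (max (max m₀ N) (n₀ + 2))
  have hmm₀ : m₀ ≤ m := ((le_max_left _ _).trans (le_max_left _ _)).trans hmM
  have hmN : N ≤ m := ((le_max_right _ _).trans (le_max_left _ _)).trans hmM
  have hmn₀ : n₀ + 2 ≤ m := (le_max_right _ _).trans hmM
  have hm1 : 1 ≤ m := by omega
  have hMpos : (0 : ℝ) < m := by exact_mod_cast hm1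
  have hM1 : (1 : ℝ) ≤ m := by exact_mod_cast hm1
  -- §4 the index `n = ⟨m, max(n₀, L(per_m))⟩`
  obtain ⟨s, hsdef⟩ : ∃ s : ℕ, s = complexity (perPoly (Fin m) ℂ) := ⟨_, rfl⟩
  rw [← hsdef] at hsmall
  obtain ⟨n, hn₀n, hun, hcompl, hnub⟩ : ∃ n : ℕ, n₀ ≤ n ∧ (Nat.unpair n).1 = m ∧
      complexity (perPoly (Fin (Nat.unpair n).1) ℂ) ≤ n ∧ n + 2 ≤ (m + n₀ + s + 2) ^ 2 := by
    refine ⟨Nat.pair m (max n₀ s), (le_max_left _ _).trans (Nat.right_le_pair _ _),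
      by rw [Nat.unpair_pair], ?_, ?_⟩
    · rw [Nat.unpair_pair, ← hsdef]
      exact (le_max_right _ _).trans (Nat.right_le_pair _ _)
    · have h1 := Nat.pair_lt_max_add_one_sq m (max n₀ s)
      have h2 : max m (max n₀ s) + 1 ≤ m + n₀ + s + 1 := by omega
      have h3 : (max m (max n₀ s) + 1) ^ 2 ≤ (m + n₀ + s + 1) ^ 2 := Nat.pow_le_pow_left h2 2
      have h4 : (m + n₀ + s + 1) ^ 2 < (m + n₀ + s + 2) ^ 2 :=
        Nat.pow_lt_pow_left (by omega) two_ne_zero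
      omega
  have hb := hn₀ n hn₀n
  simp only [hpad_of n hcompl, shadow_perPoly, totalDegree_perPoly_fin] at hb
  rw [hun] at hb
  -- `hb : L(PM_m) ≤ 2 ^ (m^(1-δ) * log (n+2)^C + C)`; Raz–Wigderson: `2^(c m) ≤ L(PM_m)`
  have hr := hm₀ m hmm₀
  have hchain := hr.trans hb
  rw [Real.rpow_le_rpow_left_iff (by norm_num : (1 : ℝ) < 2)] at hchain
  -- §5 `log (n + 2) ≤ A · m^ε`
  have hmε1 : (1 : ℝ) ≤ (m : ℝ) ^ ε := Real.one_le_rpow hM1 hε.le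
  have hmε0 : (0 : ℝ) ≤ (m : ℝ) ^ ε := by positivity
  have h2pow_pos : (0 : ℝ) < (2 : ℝ) ^ ((m : ℝ) ^ ε) := by positivity
  have h2mε : (2 : ℝ) ≤ (2 : ℝ) ^ ((m : ℝ) ^ ε) := by
    calc (2 : ℝ) = 2 ^ (1 : ℝ) := (Real.rpow_one 2).symm
      _ ≤ 2 ^ ((m : ℝ) ^ ε) := Real.rpow_le_rpow_of_exponent_le (by norm_num) hmε1
  have hs : (s : ℝ) ≤ (2 : ℝ) ^ ((m : ℝ) ^ ε) := hsmall
  have hnR : (n : ℝ) + 2 ≤ ((m : ℝ) + n₀ + s + 2) ^ 2 := by exact_mod_cast hnub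
  have hn₀R : (n₀ : ℝ) + 2 ≤ m := by exact_mod_cast hmn₀
  have h2m : (2 : ℝ) ≤ 2 * m := by linarith
  have hbase : (m : ℝ) + n₀ + s + 2 ≤ 2 * m * (2 : ℝ) ^ ((m : ℝ) ^ ε) := by
    have h' : (m : ℝ) + n₀ + s + 2 ≤ 2 * m + (2 : ℝ) ^ ((m : ℝ) ^ ε) := by linarith
    nlinarith [mul_nonneg (sub_nonneg.2 h2m) (sub_nonneg.2 h2mε)]
  have hbase_pos : (0 : ℝ) < (m : ℝ) + n₀ + s + 2 := by positivity
  have hlog_n : Real.log ((n : ℝ) + 2) ≤ 2 * Real.log (2 * m * (2 : ℝ) ^ ((m : ℝ) ^ ε)) := by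
    calc Real.log ((n : ℝ) + 2) ≤ Real.log (((m : ℝ) + n₀ + s + 2) ^ 2) :=
          Real.log_le_log (by positivity) hnR
      _ = 2 * Real.log ((m : ℝ) + n₀ + s + 2) := by rw [Real.log_pow]; norm_num
      _ ≤ 2 * Real.log (2 * m * (2 : ℝ) ^ ((m : ℝ) ^ ε)) :=
          mul_le_mul_of_nonneg_left (Real.log_le_log hbase_pos hbase) (by norm_num)
  have hlog_split : Real.log (2 * m * (2 : ℝ) ^ ((m : ℝ) ^ ε)) =
      Real.log (2 * m) + (m : ℝ) ^ ε * Real.log 2 := by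
    rw [Real.log_mul (by positivity) h2pow_pos.ne', Real.log_rpow (by norm_num)]
  have hlog2m : Real.log (2 * (m : ℝ)) ≤ 2 * (m : ℝ) ^ ε / ε := by
    have h2ε : (2 : ℝ) ^ ε ≤ 2 := by
      calc (2 : ℝ) ^ ε ≤ 2 ^ (1 : ℝ) := Real.rpow_le_rpow_of_exponent_le (by norm_num) hε1
        _ = 2 := Real.rpow_one 2
    calc Real.log (2 * (m : ℝ)) ≤ (2 * (m : ℝ)) ^ ε / ε :=
          Real.log_le_rpow_div (by positivity) hε
      _ = 2 ^ ε * (m : ℝ) ^ ε / ε := by rw [Real.mul_rpow (by norm_num) hMpos.le]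
      _ ≤ 2 * (m : ℝ) ^ ε / ε := by
          apply div_le_div_of_nonneg_right _ hε.le
          exact mul_le_mul_of_nonneg_right h2ε hmε0
  have hlog2 : Real.log 2 ≤ 1 := by
    have := Real.log_two_lt_d9
    linarith
  have hlogA : Real.log ((n : ℝ) + 2) ≤ A * (m : ℝ) ^ ε := by
    have h1 : (m : ℝ) ^ ε * Real.log 2 ≤ (m : ℝ) ^ ε := by nlinarith
    calc Real.log ((n : ℝ) + 2) ≤ 2 * (Real.log (2 * m) + (m : ℝ) ^ ε * Real.log 2) := by
          rw [← hlog_split]; exact hlog_n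
      _ ≤ 2 * (2 * (m : ℝ) ^ ε / ε + (m : ℝ) ^ ε) := by linarith
      _ = A * (m : ℝ) ^ ε := by rw [hA]; ring
  -- §6 the budget: `m^{1-δ} (log (n+2))^C ≤ A^C · m^{1-δ/2}`
  have hn0 : (0 : ℝ) ≤ n := Nat.cast_nonneg n
  have hlog_n0 : 0 ≤ Real.log ((n : ℝ) + 2) := Real.log_nonneg (by linarith)
  have hpowC : Real.log ((n : ℝ) + 2) ^ C ≤ A ^ C * (m : ℝ) ^ (ε * C) := by
    calc Real.log ((n : ℝ) + 2) ^ C ≤ (A * (m : ℝ) ^ ε) ^ C := pow_le_pow_left₀ hlog_n0 hlogA C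
      _ = A ^ C * ((m : ℝ) ^ ε) ^ C := mul_pow _ _ _
      _ = A ^ C * (m : ℝ) ^ (ε * C) := by
          rw [← Real.rpow_natCast ((m : ℝ) ^ ε) C, ← Real.rpow_mul hMpos.le]
  have hrpow0 : 0 ≤ (m : ℝ) ^ (1 - δ) := by positivity
  have hexp : (m : ℝ) ^ (1 - δ) * (m : ℝ) ^ (ε * C) ≤ (m : ℝ) ^ (1 - δ / 2) := by
    rw [← Real.rpow_add hMpos]
    exact Real.rpow_le_rpow_of_exponent_le hM1 (by linarith)
  have hbudget : (m : ℝ) ^ (1 - δ) * Real.log ((n : ℝ) + 2) ^ C ≤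
      A ^ C * (m : ℝ) ^ (1 - δ / 2) := by
    calc (m : ℝ) ^ (1 - δ) * Real.log ((n : ℝ) + 2) ^ C
        ≤ (m : ℝ) ^ (1 - δ) * (A ^ C * (m : ℝ) ^ (ε * C)) :=
          mul_le_mul_of_nonneg_left hpowC hrpow0
      _ = A ^ C * ((m : ℝ) ^ (1 - δ) * (m : ℝ) ^ (ε * C)) := by ring
      _ ≤ A ^ C * (m : ℝ) ^ (1 - δ / 2) := mul_le_mul_of_nonneg_left hexp hACpos.le
  -- §7 the window at `m`: `A^C m^{1-δ/2} + C < c m`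
  have hw := hN m hmN
  have hlogm1 : 1 ≤ Real.log ((m : ℝ) + 2) := by
    rw [Real.le_log_iff_exp_le (by positivity)]
    have := Real.exp_one_lt_d9
    linarith
  have hlogmC : 1 ≤ Real.log ((m : ℝ) + 2) ^ C := one_le_pow₀ hlogm1
  have hrpow0' : 0 ≤ (m : ℝ) ^ (1 - δ / 2) := by positivity
  have hw' : (m : ℝ) ^ (1 - δ / 2) + C < c / A ^ C * m := by
    have : (m : ℝ) ^ (1 - δ / 2) ≤ (m : ℝ) ^ (1 - δ / 2) * Real.log ((m : ℝ) + 2) ^ C :=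
      le_mul_of_one_le_right hrpow0' hlogmC
    linarith
  have hw'' : A ^ C * (m : ℝ) ^ (1 - δ / 2) + C < c * m := by
    have h1 : A ^ C * ((m : ℝ) ^ (1 - δ / 2) + C) < A ^ C * (c / A ^ C * m) :=
      mul_lt_mul_of_pos_left hw' hACpos
    have h2 : A ^ C * (c / A ^ C * (m : ℝ)) = c * m := by field_simp
    rw [mul_add, h2] at h1
    have h3 : (C : ℝ) ≤ A ^ C * C := le_mul_of_one_le_left hC0 hAC
    linarith
  linarith [hchain, hbudget, hw'']

/-- **X ⟹ `L_ℂ(per_m) > 2^{m^ε}` eventually, unconditionally** (the far side `RazWigdersonMatching`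
is the in-tree theorem `razWigdersonMatching_proof`). This places the crux: any proof of
`ShadowFormulaTransfer` is a `2^{m^{Ω(1)}}` arithmetic-circuit lower bound for the permanent over
`ℂ`, far above the summit `per ∉ VP_ℂ`. [folklore] -/
theorem two_pow_rpow_lt_complexity_per (hX : ShadowFormulaTransfer) :
    ∃ ε : ℝ, 0 < ε ∧ ∃ m₀ : ℕ, ∀ m ≥ m₀,
      (2 : ℝ) ^ ((m : ℝ) ^ ε) < (complexity (perPoly (Fin m) ℂ) : ℝ) :=
  two_pow_rpow_lt_complexity_per_of_razWigderson
    Summit.ValiantsHypothesis.ValiantsHypothesis.Theorems.ShallowShadowsRazWigdersonMatching.razWigdersonMatching_proof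
    hX

/-- **X ⟹ `per ∉ VQP_ℂ`** — the EXTENDED VALIANT HYPOTHESIS `VNP ⧵ VQP ≠ ∅` (Bürgisser–Clausen–
Shokrollahi (21.32); over `ℂ` equivalent to `per ∉ VQP_ℂ`, (21.41) "PER is not a qp-projection of
DET", and listed as open Problem 21.5) follows from X: quasi-polynomial size `2^{(log₂ m + c)^c}` is
eventually below `2^{m^ε}`. [cite: BurgisserClausenShokrollahi1997, (21.32), (21.41), Problem 21.5]
[cite: Burgisser2000, Def. 2.26] -/
theorem not_isVQPFamily_per (hX : ShadowFormulaTransfer) :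
    ¬ IsVQPFamily (fun n => perPoly (Fin n) ℂ) := by
  rintro ⟨-, c, hc⟩
  obtain ⟨ε, hε, m₀, hm₀⟩ := two_pow_rpow_lt_complexity_per hX
  have hlo := isLittleO_log_rpow_rpow_atTop (c : ℝ) hε
  have hpos : (0 : ℝ) < 1 / 3 ^ c := by positivity
  obtain ⟨N, hN⟩ := eventually_atTop.mp ((tendsto_natCast_atTop_atTop (R := ℝ)).eventually
    ((hlo.def hpos).and (Real.tendsto_log_atTop.eventually_ge_atTop (c : ℝ))))
  -- the witness size
  obtain ⟨m, hmm₀, hmN, hm1⟩ : ∃ m : ℕ, m₀ ≤ m ∧ N ≤ m ∧ 1 ≤ m :=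
    ⟨max (max m₀ N) 1, (le_max_left _ _).trans (le_max_left _ _),
      (le_max_right _ _).trans (le_max_left _ _), le_max_right _ _⟩
  have hMpos : (0 : ℝ) < m := by exact_mod_cast hm1
  have hlogm0 : 0 ≤ Real.log (m : ℝ) := Real.log_nonneg (by exact_mod_cast hm1)
  obtain ⟨hlo', hlogc⟩ := hN m hmN
  have hlow := hm₀ m hmm₀
  have hup : (complexity (perPoly (Fin m) ℂ) : ℝ) ≤ (2 : ℝ) ^ (((Nat.log 2 m + c) ^ c : ℕ) : ℝ) := by
    rw [Real.rpow_natCast]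
    exact_mod_cast hc m
  have hlt := hlow.trans_le hup
  rw [Real.rpow_lt_rpow_left_iff (by norm_num : (1 : ℝ) < 2)] at hlt
  push_cast at hlt
  -- `hlt : m^ε < (Nat.log 2 m + c)^c`; but `Nat.log 2 m + c ≤ 2 log m + c ≤ 3 log m`
  have hnatlog : ((Nat.log 2 m : ℕ) : ℝ) ≤ 2 * Real.log (m : ℝ) := by
    have h := Real.natLog_le_logb m 2
    push_cast at h
    rw [Real.logb, le_div_iff₀ (Real.log_pos (by norm_num : (1 : ℝ) < 2))] at h
    have hx0 : (0 : ℝ) ≤ ((Nat.log 2 m : ℕ) : ℝ) := Nat.cast_nonneg _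
    have hl2 : (1 / 2 : ℝ) ≤ Real.log 2 := by
      have := Real.log_two_gt_d9
      linarith
    have h' : ((Nat.log 2 m : ℕ) : ℝ) * (1 / 2) ≤ Real.log (m : ℝ) :=
      (mul_le_mul_of_nonneg_left hl2 hx0).trans h
    linarith
  have hsum : ((Nat.log 2 m : ℕ) : ℝ) + c ≤ 3 * Real.log (m : ℝ) := by linarith
  have hsum0 : (0 : ℝ) ≤ ((Nat.log 2 m : ℕ) : ℝ) + c := by positivity
  have hlo'' : Real.log (m : ℝ) ^ c ≤ 1 / 3 ^ c * (m : ℝ) ^ ε := by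
    have h := hlo'
    have hnn : 0 ≤ Real.log (m : ℝ) ^ (c : ℝ) := by
      rw [Real.rpow_natCast]; exact pow_nonneg hlogm0 c
    rw [Real.norm_of_nonneg hnn, Real.norm_of_nonneg (by positivity), Real.rpow_natCast] at h
    exact h
  have hfin : (((Nat.log 2 m : ℕ) : ℝ) + c) ^ c ≤ (m : ℝ) ^ ε := by
    calc (((Nat.log 2 m : ℕ) : ℝ) + c) ^ c ≤ (3 * Real.log (m : ℝ)) ^ c :=
          pow_le_pow_left₀ hsum0 hsum c
      _ = 3 ^ c * Real.log (m : ℝ) ^ c := mul_pow _ _ _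
      _ ≤ 3 ^ c * (1 / 3 ^ c * (m : ℝ) ^ ε) := mul_le_mul_of_nonneg_left hlo'' (by positivity)
      _ = (m : ℝ) ^ ε := by field_simp
  linarith

end Summit.ValiantsHypothesis.ValiantsHypothesis.Theorems.ShadowFormulaTransfer.Negative.SummitStrength

end
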